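import Literature.Barriers.CriticalPhenomena.PlaquetteWalkDominoRigidity
import Literature.Barriers.CriticalPhenomena.PlaquetteWalkDegenerateIdentity
import HarnessLib

/-!
# Barrier catalogue (SAWScalingLimit): the domino identities of the directed branches `u₁ = 0` / `u₂ = 0`
of the five-weight plaquette walk on `ℤ²` — the walk half of the two-plaquette theory

Companion of `PlaquetteWalkDominoRigidity` (definitions `ExactDominoVertexRelation`, the six two-plaquette
rows `DominoRows`, the closed-form vectors `branchDominoCoeff` / `branchDominoCoeffMirror`, necessity of
the rows, generic triviality) and of `PlaquetteWalkDegenerateIdentity` (★ no walk doubles all its corner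
plaquettes). Here the rows are shown SUFFICIENT on the directed branches and the branch classes are
classified two-sidedly:

* On `u₁ = 0` every walk of nonzero weight is corner-free (`exists_kindsIn_eq_corner`), hence never returns
  to a plaquette (`ΩF.no_arc_of_cornerFree`): ★ `vertexFunctional_eq_sum_freshRow` — for ANY coefficients
  the vertex functional is the sum over FRESH arrivals of (exterior weight) × (phase) × (plaquette row);
  ★ `sum_fresh_shared_eq` — transfer through the shared side: the fresh arrivals at `f` through its east
  side ARE the one-arc extensions of the fresh outside arrivals at `f⁺` (the `base`/`ext` bijection of
  the grouping at `f⁺`); hence ★★ `exactDominoVertexRelation_of_dominoRows` (six vanishing rows ⇒ an exact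
  domino relation everywhere), `exactDominoVertexRelation_branch` (the closed-form vector is exact on the
  WHOLE hyperplane `{u₁ = 0}`), ★ `domino_not_plaquette` (off the quartic `(1 ± v)² = u₂²` NO one-plaquette
  relation exists there — `exactPlaquetteVertexRelation_iff_quartic_of_u₁_eq_zero` — so the domino class is
  STRICTLY LARGER than the plaquette class); the mirror branch `u₂ = 0` likewise (§ MirrorBranch).
* § TwoSided: with the necessity of the rows (`PlaquetteWalkDominoRigidity`), on each branch the domino
  class IS the six-row space (`exactDominoVertexRelation_iff_dominoRows_of_u₁/u₂_eq_zero`) and, off the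
  branch's quartic, the SINGLE LINE through the closed-form vector
  (`exactDominoVertexRelation_iff_sym_of_u₁/u₂_eq_zero` with `dominoRows_proportional_…`).
* Named: `PlaquetteWalkDominoIdentity(_holds)` (both hyperplanes).

Sources: [cite: GlazmanManolescu2019, §1 Fig. 1, eq. (1); §2.1 eq. (2.1); Lemma 2.1 (grouping of the walks
at a rhombus)]; [cite: DuminilCopinSmirnov2012, Lemma 1]; [cite: Glazman2015WeightedSAW, Lemma 3.1 (proof
by the one-visit group, eq. (3.11))]; [cite: JansevanRensburg2015, §4.6 (Temperley method: local linear
recursions for the generating functions of partially directed walks — u_n = u_n^r + u_n^u, eq. (4.197),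
Fig. 4.24)]. Status in print: mechanism CONSOLIDATION (folklore transfer recursions); the typed statements
and the comparison «domino class ⊋ plaquette class» are the venture lane's («pcv-sawmu», Tier B SEARCH 1,
b-engine-1 gen 14; HOME/FINDING-Z2-DOMINO-CLASS.md) — NEW-IN-WRITING (modest).

Implementation note: the grouping lemmas `ext_fst`, `ext_snd_arcs`, `ext_snd_nth`, `ext_snd_length`,
`mem_admSet`, `adm_of_no_arc`, `ends_ne_of_arc`, `side_five`, `arcKind_self`, `qTurn_self`,
`quarterTurnsL_of_snoc`, `qTurnOf_side_side`, `kindsIn_eq_filterMap_filter` are private lemmas of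
`PlaquetteWalkDegenerateIdentity`, read via `open private … from`; `vertexFunctional_eq_sum_freshRow` is that
file's `exactPlaquetteVertexRelation_of_u₁_eq_zero` with the row kept instead of assumed zero.
-/

noncomputable section

open Complex

namespace Literature.Barriers.CriticalPhenomena

open Literature.Probability.RandomPlanarGeometry.SAW.YangBaxter

namespace PlaquetteWalk

/-! ## The directed branch `u₁ = 0`: fresh-arrival rows and the domino identity

Walk-combinatorial part (imports `PlaquetteWalkDegenerateIdentity`): on `u₁ = 0` every walk of nonzero
weight is corner-free (★ `exists_kindsIn_eq_corner`: no walk doubles all its corner plaquettes), hence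
never returns to a plaquette (`ΩF.no_arc_of_cornerFree`); so the vertex functional at a plaquette is the
sum over the FRESH arrivals of (exterior weight × phase × plaquette row of the arrival side)
(`vertexFunctional_eq_sum_freshRow`), the arrivals at `f` through the shared side are exactly the one-arc
extensions into the shared side of the fresh outside-arrivals at `f⁺` (`sum_fresh_shared_eq`), and the six
two-plaquette rows give the domino identity (`exactDominoVertexRelation_of_dominoRows`). -/

section Branch

open ΩF

open private ext_fst ext_snd_arcs ext_snd_nth ext_snd_length mem_admSet adm_of_no_arc ends_ne_of_arc side_five
  arcKind_self qTurn_self quarterTurnsL_of_snoc qTurnOf_side_side kindsIn_eq_filterMap_filter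
  from Literature.Barriers.CriticalPhenomena.PlaquetteWalkDegenerateIdentity

variable {D : Set Face} {a z : MidEdge} {Dl : List Face} {f₀ : Face} {W : CWeights} {t : ℂ}

/-- On `u₁ = 0` a walk that is not corner-free weighs `0`: its corner arc of maximal level sits alone in
its plaquette (★ `exists_kindsIn_eq_corner`), which then weighs `u₁ = 0`.
[cite: GlazmanManolescu2019, §1, Fig. 1, eq. (1) (one corner arc weighs u₁)] -/
theorem weightL_eq_zero_of_not_cornerFree (h1 : W.u₁ = 0) (γ : YBWalk D a z) (h : ¬CornerFree γ) :
    weightL W γ.mids = 0 := by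
  simp only [CornerFree, not_forall, not_not, exists_prop] at h
  obtain ⟨j, hj, hkj⟩ := h
  obtain ⟨g, hg⟩ := exists_kindsIn_eq_corner γ hj hkj
  rw [weightL_eq_extW_mul W γ g, hg, locW_single, arcW, h1, mul_zero]

/-- An arc of a walk in `g` shows in `kindsIn g`; so `kindsIn g = []` means no arc in `g`. [cite: GlazmanManolescu2019, §2.1 (walks of a finite domain started at a boundary mid-edge)] -/
theorem no_arc_of_kindsIn_eq_nil (γ : YBWalk D a z) {g : Face} (hK : γ.kindsIn g = []) :
    ∀ i, i < γ.arcs.length → arcFace (γ.nth i, γ.nth (i + 1)) ≠ some g := by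
  intro i hi hface
  obtain ⟨s, u, _, _, _, hk⟩ := exists_sides_of_arcFace hface
  have hmem : arcKind s u ∈ γ.kindsIn g := by
    rw [YBWalk.kindsIn_eq, List.mem_filterMap]
    exact ⟨_, γ.arc_nth_mem hi, by rw [kindF, if_pos hface, hk]⟩
  rw [hK] at hmem
  simp at hmem

/-- Conversely, no arc in `g` means `kindsIn g = []`. [cite: GlazmanManolescu2019, §2.1 (walks of a finite domain started at a boundary mid-edge)] -/
theorem kindsIn_eq_nil_of_no_arc (γ : YBWalk D a z) {g : Face}
    (hno : ∀ i, i < γ.arcs.length → arcFace (γ.nth i, γ.nth (i + 1)) ≠ some g) : γ.kindsIn g = [] := by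
  apply YBWalk.kindsIn_eq_nil
  intro hg
  obtain ⟨p, hp, hpg⟩ := (γ.mem_facesVisited_iff).1 hg
  obtain ⟨i, hi, rfl⟩ := (γ.mem_arcs_iff_nth).1 hp
  exact hno i hi hpg

/-- ★ **Fresh-arrival rows on `u₁ = 0`**: for ANY coefficient vector the vertex functional at `f₀` is the
sum, over the arrival walks at `f₀` that have not crossed `f₀` before, of
(exterior weight) × (phase) × (plaquette row of the arrival side). Groups of returning arrivals vanish:
a returning walk is not corner-free, so some plaquette other than `f₀` carries a single corner arc and
weighs `u₁ = 0`. (The proof of `exactPlaquetteVertexRelation_of_u₁_eq_zero`, with the row kept.)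
[cite: Glazman2015WeightedSAW, Lemma 3.1 (proof: the one-visit group, eq. (3.11))] -/
theorem vertexFunctional_eq_sum_freshRow (ht : t ≠ 0) (h1 : W.u₁ = 0) (c : Fin 4 → ℂ) (hf : f₀ ∈ Dl)
    (ha : IsBoundaryRoot Dl a) :
    vertexFunctional W t c Dl a f₀ = ∑ ω ∈ setArr Dl a f₀,
      if ω.2.kindsIn f₀ = [] then extW W ω.2 f₀ * t ^ quarterTurnsL ω.2.mids * plaqRow W t c ω.1 else 0 := by
  rw [vertexFunctional_eq_sum_term, sum_eq_sum_bracket hf]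
  refine Finset.sum_congr rfl fun ω hω => ?_
  have h : ¬ω.IsExt := by simpa [setArr] using hω
  set p := ω.1 with hp
  set E := extW W ω.2 f₀ with hE
  set T := t ^ quarterTurnsL ω.2.mids with hT
  have hself : term W t c ω = c (slotIdx p) * (E * locW W (ω.2.kindsIn f₀) * T) := by
    rw [term, weightL_eq_extW_mul]
  have hext : ∀ x ∈ ω.admSet, term W t c (ω.ext hf x) =
      E * T * (c (slotIdx x) * locW W (ω.2.kindsIn f₀ ++ [arcKind p x]) * t ^ qTurn p x) := by
    intro x hx
    have hx' : ω.Adm x := mem_admSet.1 hx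
    have harcs := ext_snd_arcs hf h hx'
    have hpx : p ≠ x := Ne.symm hx'.1
    have hfa : arcFace (f₀.side p, f₀.side x) = some f₀ := arcFace_side_side f₀ p x hpx
    rw [term, weightL_eq_extW_mul W _ f₀, extW_of_snoc W ω.2 _ f₀ harcs hfa,
      YBWalk.kindsIn_of_snoc ω.2 _ f₀ harcs hfa, arcKindOf_eq hfa rfl rfl,
      quarterTurnsL_of_snoc ω.2 _ harcs, qTurnOf_side_side f₀ hpx, zpow_add₀ ht, ext_fst hf h hx']
    simp only [List.reduceOption_cons_of_some, List.reduceOption_nil]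
    ring
  have hextE : ∀ x ∈ ω.admSet, ∀ g, g ≠ f₀ → (ω.ext hf x).2.kindsIn g = ω.2.kindsIn g := by
    intro x hx g hg
    have hx' : ω.Adm x := mem_admSet.1 hx
    exact YBWalk.kindsIn_of_snoc_of_ne ω.2 _ f₀ (ext_snd_arcs hf h hx')
      (arcFace_side_side f₀ p x (Ne.symm hx'.1)) hg
  rw [hself, Finset.sum_congr rfl hext, ← Finset.mul_sum]
  have hfilt : ∀ {i : ℕ}, i < ω.2.arcs.length → arcFace (ω.2.nth i, ω.2.nth (i + 1)) = some f₀ →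
      (ω.2.nth i, ω.2.nth (i + 1)) ∈ (arcsOf ω.2.mids).filter fun q => arcFace q = some f₀ :=
    fun hi e => List.mem_filter.2 ⟨ω.2.arc_nth_mem hi, by simpa using e⟩
  rcases filter_face_cases ω.2 f₀ with h0 | ⟨q₁, hq1, hq₁⟩ | ⟨q₁, q₂, h2, hne, hq₁, hq₂, -⟩
  · -- fresh plaquette: the row of the arrival side
    have hK : ω.2.kindsIn f₀ = [] := by rw [kindsIn_eq_filterMap_filter, h0]; rfl
    have hno : ∀ i < ω.2.arcs.length, arcFace (ω.2.nth i, ω.2.nth (i + 1)) ≠ some f₀ := by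
      intro i hi e
      have := hfilt hi e
      rw [h0] at this
      simp at this
    have hadm : ω.admSet = Finset.univ.erase p := by
      ext x
      simp only [mem_admSet, Finset.mem_erase, Finset.mem_univ, and_true]
      exact ⟨fun hx => hx.1, fun hx => adm_of_no_arc hf ha h hno hx⟩
    rw [hK, hadm, if_pos rfl, plaqRow, ← Finset.add_sum_erase _ _ (Finset.mem_univ p), arcKind_self,
      qTurn_self]
    simp only [List.nil_append, locW_single, locW_nil, arcW, zpow_zero, mul_one]
    ring
  · -- one earlier arc `q₁` in `f₀`, at index `i`: the group vanishes
    have hq₁m : q₁ ∈ ω.2.arcs := by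
      have : q₁ ∈ (arcsOf ω.2.mids).filter fun q => arcFace q = some f₀ := by rw [hq1]; simp
      exact (List.mem_filter.1 this).1
    obtain ⟨s₁, s₂, h12, hs₁, hs₂, hk⟩ := exists_sides_of_arcFace hq₁
    obtain ⟨i, hi, hqi⟩ := (ω.2.mem_arcs_iff_nth).1 hq₁m
    have hK : ω.2.kindsIn f₀ = [arcKind s₁ s₂] := by
      rw [kindsIn_eq_filterMap_filter, hq1, List.filterMap_cons, hk, List.filterMap_nil]
    rw [hK, if_neg (List.cons_ne_nil _ _)]
    by_cases hkc : arcKind s₁ s₂ = .corner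
    · have hE0 : ∀ x ∈ ω.admSet, E = 0 := by
        intro x hx
        have hx' : ω.Adm x := mem_admSet.1 hx
        have harcs := ext_snd_arcs hf h hx'
        have hq₁m' : q₁ ∈ (ω.ext hf x).2.arcs := by rw [harcs]; exact List.mem_append_left _ hq₁m
        obtain ⟨g, hg⟩ := exists_kindsIn_eq_corner_of_mem _ hq₁m' (by rw [hk, hkc])
        have hfa : arcFace (f₀.side p, f₀.side x) = some f₀ := arcFace_side_side f₀ p x (Ne.symm hx'.1)
        have hgf : g ≠ f₀ := by
          intro e
          rw [e, YBWalk.kindsIn_of_snoc ω.2 _ f₀ harcs hfa, hK, arcKindOf_eq hfa rfl rfl] at hg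
          simp at hg
        rw [hextE x hx g hgf] at hg
        exact extW_eq_zero_of_kindsIn_corner h1 ω.2 hg hgf
      rw [hkc]
      have hu : locW W [ArcKind.corner] = 0 := by rw [locW_single, arcW, h1]
      rw [hu]
      by_cases hne : ω.admSet = ∅
      · rw [hne, Finset.sum_empty]; ring
      · obtain ⟨x, hx⟩ := Finset.nonempty_iff_ne_empty.2 hne
        rw [hE0 x hx]; ring
    · have hncf : ¬CornerFree ω.2 := fun hcf =>
        no_arc_of_cornerFree ω h hcf i hi (by rw [← hqi]; exact hq₁)
      simp only [CornerFree, not_forall, not_not, exists_prop] at hncf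
      obtain ⟨j, hj, hkj⟩ := hncf
      obtain ⟨g, hg⟩ := exists_kindsIn_eq_corner ω.2 hj hkj
      have hgf : g ≠ f₀ := by
        rintro rfl
        rw [hK] at hg
        exact hkc (List.singleton_injective hg)
      have hE0 : E = 0 := extW_eq_zero_of_kindsIn_corner h1 ω.2 hg hgf
      rw [hE0]
      ring
  · -- two arcs in `f₀`: impossible for an arrival
    exfalso
    have hm : ∀ q, q ∈ [q₁, q₂] → q ∈ ω.2.arcs := by
      intro q hq
      have : q ∈ (arcsOf ω.2.mids).filter fun q => arcFace q = some f₀ := by rw [h2]; exact hq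
      exact (List.mem_filter.1 this).1
    have hq₁m := hm q₁ (by simp)
    have hq₂m := hm q₂ (by simp)
    obtain ⟨e11, e12, e21, e22⟩ := arcs_ends_ne ω.2 hq₁m hq₂m hne hq₁ hq₂
    obtain ⟨s₁, s₂, h12, hs₁, hs₂, -⟩ := exists_sides_of_arcFace hq₁
    obtain ⟨s₃, s₄, h34, hs₃, hs₄, -⟩ := exists_sides_of_arcFace hq₂
    obtain ⟨i, hi, hqi⟩ := (ω.2.mem_arcs_iff_nth).1 hq₁m
    obtain ⟨j, hj, hqj⟩ := (ω.2.mem_arcs_iff_nth).1 hq₂m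
    obtain ⟨hne₁, hne₂⟩ := ends_ne_of_arc h hi (by rw [← hqi]; exact hq₁)
    obtain ⟨hne₃, hne₄⟩ := ends_ne_of_arc h hj (by rw [← hqj]; exact hq₂)
    rw [hqi] at hs₁ hs₂
    rw [hqj] at hs₃ hs₄
    rw [hqi, hqj] at e11 e12 e21 e22
    simp only at hs₁ hs₂ hs₃ hs₄ e11 e12 e21 e22
    rw [← hs₁] at e11 e12 hne₁
    rw [← hs₂] at e21 e22 hne₂
    rw [← hs₃] at e11 e21 hne₃
    rw [← hs₄] at e12 e22 hne₄
    have n13 : s₁ ≠ s₃ := fun e => e11 (by rw [e])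
    have n14 : s₁ ≠ s₄ := fun e => e12 (by rw [e])
    have n23 : s₂ ≠ s₃ := fun e => e21 (by rw [e])
    have n24 : s₂ ≠ s₄ := fun e => e22 (by rw [e])
    have n1 : ω.1 ≠ s₁ := fun e => hne₁ (by rw [e])
    have n2 : ω.1 ≠ s₂ := fun e => hne₂ (by rw [e])
    have n3 : ω.1 ≠ s₃ := fun e => hne₃ (by rw [e])
    have n4 : ω.1 ≠ s₄ := fun e => hne₄ (by rw [e])
    exact side_five h12 n13 n14 n23 n24 h34 n1 n2 n3 n4

/-! ### Transfer through the shared side -/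

variable {f : Face}

/-- The west face of the shared side is `f`. [cite: GlazmanManolescu2019, §2.1 (walks of a finite domain started at a boundary mid-edge)] -/
theorem faces_shared_fst (f : Face) : (f.side .E).faces.1 = f := by
  obtain ⟨x, y⟩ := f
  simp [Face.side, MidEdge.faces]

/-- The east face of the shared side is `f⁺`. [cite: GlazmanManolescu2019, §2.1 (walks of a finite domain started at a boundary mid-edge)] -/
theorem faces_shared_snd (f : Face) : (f.side .E).faces.2 = east f := rfl

/-- The shared side of a domino inside the face list is not a boundary root. [cite: GlazmanManolescu2019, §2.1 (walks start on the boundary of the domain)] -/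
theorem ne_shared_of_isBoundaryRoot (hf : f ∈ Dl) (hf' : east f ∈ Dl) (ha : IsBoundaryRoot Dl a) :
    a ≠ f.side .E := by
  rintro rfl
  rcases ha with ⟨-, h2⟩ | ⟨h1, -⟩
  · exact h2 (by rw [faces_shared_snd]; exact hf')
  · exact h1 (by rw [faces_shared_fst]; exact hf)

/-- A walk from a boundary root to the shared side has an arc. [cite: GlazmanManolescu2019, §2.1 (walks of a finite domain started at a boundary mid-edge)] -/
theorem arcs_length_pos_of_shared (hf : f ∈ Dl) (hf' : east f ∈ Dl) (ha : IsBoundaryRoot Dl a)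
    (γ : YBWalk (dom Dl) a (f.side .E)) : 0 < γ.arcs.length := by
  by_contra h0
  have h0' : γ.arcs.length = 0 := by omega
  have e1 := γ.nth_length
  rw [h0', YBWalk.nth_zero] at e1
  exact ne_shared_of_isBoundaryRoot hf hf' ha e1

/-- The last arc of a walk ending at the shared side lies in `f` or in `f⁺`. [cite: GlazmanManolescu2019, §2.1 (walks of a finite domain started at a boundary mid-edge)] -/
theorem last_arcFace_shared (γ : YBWalk (dom Dl) a (f.side .E)) (hn : 0 < γ.arcs.length) :
    arcFace (γ.nth (γ.arcs.length - 1), γ.nth γ.arcs.length) = some f ∨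
      arcFace (γ.nth (γ.arcs.length - 1), γ.nth γ.arcs.length) = some (east f) := by
  obtain ⟨g, -, hg⟩ := γ.arc_nth (show γ.arcs.length - 1 < γ.arcs.length by omega)
  rw [show γ.arcs.length - 1 + 1 = γ.arcs.length by omega] at hg
  have h2 := (MidEdge.commonFace_eq_some hg).2.2
  rw [YBWalk.nth_length, faces_shared_fst, faces_shared_snd] at h2
  rcases h2 with rfl | rfl
  · exact Or.inl hg
  · exact Or.inr hg

/-- A walk at the shared side that has not crossed `f` is the one-arc extension class at `f⁺` (its last
arc lies in `f⁺`). [cite: GlazmanManolescu2019, §2.1 (walks of a finite domain started at a boundary mid-edge)] -/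
theorem isExt_east_of_kindsIn_eq_nil (hf : f ∈ Dl) (hf' : east f ∈ Dl) (ha : IsBoundaryRoot Dl a)
    (γ : YBWalk (dom Dl) a (f.side .E)) (hK : γ.kindsIn f = []) :
    ΩF.IsExt (⟨.W, γ⟩ : ΩF Dl a (east f)) := by
  have hn := arcs_length_pos_of_shared hf hf' ha γ
  refine ⟨hn, ?_⟩
  rcases last_arcFace_shared γ hn with h | h
  · exact absurd h (by
      have := no_arc_of_kindsIn_eq_nil γ hK (γ.arcs.length - 1) (by omega)
      rwa [show γ.arcs.length - 1 + 1 = γ.arcs.length by omega] at this)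
  · have e : γ.nth γ.arcs.length = (east f).side .W := γ.nth_length
    rw [e] at h
    exact h

/-- A walk at the shared side that has not crossed `f` is an arrival at `f` (its last arc is not in `f`).
[cite: GlazmanManolescu2019, §2.1 (walks of a finite domain started at a boundary mid-edge)] -/
theorem not_isExt_of_kindsIn_eq_nil (γ : YBWalk (dom Dl) a (f.side .E)) (hK : γ.kindsIn f = []) :
    ¬ΩF.IsExt (⟨.E, γ⟩ : ΩF Dl a f) := by
  rintro ⟨hn, h⟩
  have hn' : 0 < γ.arcs.length := hn
  have := no_arc_of_kindsIn_eq_nil γ hK (γ.arcs.length - 1) (by omega)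
  rw [show γ.arcs.length - 1 + 1 = γ.arcs.length by omega] at this
  exact this (by simpa using h)

/-- The weight-and-phase of a walk. [cite: GlazmanManolescu2019, §2.1, eq. (2.1)] -/
def wt (W : CWeights) (t : ℂ) (γ : YBWalk D a z) : ℂ := weightL W γ.mids * t ^ quarterTurnsL γ.mids

/-- ★ **Transfer through the shared side** (`u₁ = 0`): the fresh arrivals at `f` through its east side,
weighted by exterior weight × phase, equal the fresh OUTSIDE arrivals at `f⁺`, weighted by exterior
weight × phase × (one-arc weight into the west side of `f⁺`). Mechanism: the former are exactly the
one-arc extensions into the shared side of the latter (the `base`/`ext` bijection of the grouping at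
`f⁺`); an extension that had crossed `f` before, or whose arrival had crossed `f⁺` before, is a returning
walk, not corner-free, of weight `0`. [cite: Glazman2015WeightedSAW, Lemma 3.1 (proof: walks in a group differ only inside the rhombus)] -/
theorem sum_fresh_shared_eq (ht : t ≠ 0) (h1 : W.u₁ = 0) (hf : f ∈ Dl) (hf' : east f ∈ Dl)
    (ha : IsBoundaryRoot Dl a) :
    (∑ ω ∈ setArr Dl a f, if ω.2.kindsIn f = [] ∧ ω.1 = .E then extW W ω.2 f * t ^ quarterTurnsL ω.2.mids
      else 0) =
    ∑ ω ∈ setArr Dl a (east f), if ω.2.kindsIn (east f) = [] ∧ ω.1 ≠ .W then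
      extW W ω.2 (east f) * t ^ quarterTurnsL ω.2.mids * (arcW W (arcKind ω.1 .W) * t ^ qTurn ω.1 .W)
      else 0 := by
  classical
  -- Step 1: the left side as a sum over all walks ending at the shared side
  have hL : (∑ ω ∈ setArr Dl a f, if ω.2.kindsIn f = [] ∧ ω.1 = .E then
      extW W ω.2 f * t ^ quarterTurnsL ω.2.mids else 0) =
      ∑ γ : YBWalk (dom Dl) a (f.side .E), if γ.kindsIn f = [] then wt W t γ else 0 := by
    have e1 : (∑ ω ∈ setArr Dl a f, if ω.2.kindsIn f = [] ∧ ω.1 = .E then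
        extW W ω.2 f * t ^ quarterTurnsL ω.2.mids else 0) =
        ∑ ω : ΩF Dl a f, if ω.2.kindsIn f = [] ∧ ω.1 = .E then wt W t ω.2 else 0 := by
      rw [setArr, Finset.sum_filter]
      refine Finset.sum_congr rfl fun ω _ => ?_
      by_cases hc : ω.2.kindsIn f = [] ∧ ω.1 = .E
      · obtain ⟨s, γ⟩ := ω
        obtain ⟨hK, hs⟩ := hc
        simp only at hs
        subst hs
        rw [if_pos (not_isExt_of_kindsIn_eq_nil γ hK), if_pos (show γ.kindsIn f = [] ∧ Side.E = Side.E from ⟨hK, rfl⟩),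
          if_pos (show γ.kindsIn f = [] ∧ Side.E = Side.E from ⟨hK, rfl⟩), wt,
          weightL_eq_extW_mul W γ f, hK, locW_nil, mul_one]
      · rw [if_neg hc]
        split_ifs <;> rfl
    rw [e1, Fintype.sum_sigma]
    rw [Fintype.sum_eq_single Side.E (fun s hs => by
      refine Finset.sum_eq_zero fun γ _ => ?_
      rw [if_neg (fun hc => hs hc.2)])]
    refine Finset.sum_congr rfl fun γ _ => ?_
    by_cases hK : γ.kindsIn f = []
    · rw [if_pos (show γ.kindsIn f = [] ∧ Side.E = Side.E from ⟨hK, rfl⟩), if_pos hK]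
    · rw [if_neg (show ¬(γ.kindsIn f = [] ∧ Side.E = Side.E) from fun hc => hK hc.1), if_neg hK]
  -- Step 2: the same sum through the extension class at `f⁺`
  set G : ΩF Dl a (east f) → ℂ := fun ω => if ω.1 = .W ∧ ω.2.kindsIn f = [] then wt W t ω.2 else 0
    with hG
  have hLM : (∑ γ : YBWalk (dom Dl) a (f.side .E), if γ.kindsIn f = [] then wt W t γ else 0) =
      ∑ γ : YBWalk (dom Dl) a ((east f).side .W), if γ.kindsIn f = [] then wt W t γ else 0 := rfl
  have hM : (∑ γ : YBWalk (dom Dl) a ((east f).side .W), if γ.kindsIn f = [] then wt W t γ else 0) =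
      ∑ ω ∈ setExt Dl a (east f), G ω := by
    rw [setExt, Finset.sum_filter, Fintype.sum_sigma]
    rw [Fintype.sum_eq_single Side.W (fun s hs => by
      refine Finset.sum_eq_zero fun γ _ => ?_
      rw [hG]
      beta_reduce
      rw [if_neg (show ¬(s = Side.W ∧ γ.kindsIn f = []) from fun hc => hs hc.1)]
      split_ifs <;> rfl)]
    refine Finset.sum_congr rfl fun γ _ => ?_
    rw [hG]
    beta_reduce
    by_cases hK : γ.kindsIn f = []
    · rw [if_pos hK, if_pos (isExt_east_of_kindsIn_eq_nil hf hf' ha γ hK),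
        if_pos (show Side.W = Side.W ∧ γ.kindsIn f = [] from ⟨rfl, hK⟩)]
    · rw [if_neg hK]
      split_ifs with h1' h2'
      · exact absurd h2'.2 hK
      · rfl
      · rfl
  rw [hL, hLM, hM, sum_ext hf' G]
  -- Step 3: compare group by group over the arrivals at `f⁺`
  refine Finset.sum_congr rfl fun ω hω => ?_
  have h : ¬ω.IsExt := by simpa [setArr] using hω
  -- the extension into the shared side, when admissible: its label, weight and corner-freeness
  have hextW : ω.Adm .W → (ω.ext hf' .W).1 = .W ∧
      wt W t (ω.ext hf' .W).2 = extW W ω.2 (east f) * locW W (ω.2.kindsIn (east f) ++ [arcKind ω.1 .W]) *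
        (t ^ quarterTurnsL ω.2.mids * t ^ qTurn ω.1 .W) := by
    intro hx
    have harcs := ext_snd_arcs hf' h hx
    have hpx : ω.1 ≠ .W := Ne.symm hx.1
    have hfa : arcFace ((east f).side ω.1, (east f).side .W) = some (east f) :=
      arcFace_side_side (east f) ω.1 .W hpx
    refine ⟨ext_fst hf' h hx, ?_⟩
    rw [wt, weightL_eq_extW_mul W _ (east f), extW_of_snoc W ω.2 _ (east f) harcs hfa,
      YBWalk.kindsIn_of_snoc ω.2 _ (east f) harcs hfa, arcKindOf_eq hfa (s := ω.1) (t := Side.W) rfl rfl,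
      quarterTurnsL_of_snoc ω.2 _ harcs, qTurnOf_side_side (east f) hpx, zpow_add₀ ht]
    simp only [List.reduceOption_cons_of_some, List.reduceOption_nil]
  -- the inner sum over the admissible sides is the single term `x = W` (if admissible)
  have hinner : (∑ x ∈ ω.admSet, G (ω.ext hf' x)) =
      if ω.Adm .W then (if (ω.ext hf' .W).2.kindsIn f = [] then wt W t (ω.ext hf' .W).2 else 0) else 0 := by
    by_cases hW : ω.Adm .W
    · rw [if_pos hW, Finset.sum_eq_single_of_mem Side.W (mem_admSet.2 hW) (fun x hx hxW => by
        have hx' : ω.Adm x := mem_admSet.1 hx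
        rw [hG]
        beta_reduce
        rw [if_neg (show ¬((ω.ext hf' x).1 = Side.W ∧ (ω.ext hf' x).2.kindsIn f = []) from
          fun hc => hxW ((ext_fst hf' h hx').symm.trans hc.1))])]
      rw [hG]
      beta_reduce
      have hδ1 : (ω.ext hf' .W).1 = .W := (hextW hW).1
      by_cases hK : (ω.ext hf' .W).2.kindsIn f = []
      · rw [if_pos (show (ω.ext hf' Side.W).1 = Side.W ∧ (ω.ext hf' Side.W).2.kindsIn f = [] from ⟨hδ1, hK⟩),
          if_pos hK]
      · rw [if_neg (show ¬((ω.ext hf' Side.W).1 = Side.W ∧ (ω.ext hf' Side.W).2.kindsIn f = []) from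
          fun hc => hK hc.2), if_neg hK]
    · rw [if_neg hW]
      refine Finset.sum_eq_zero fun x hx => ?_
      have hx' : ω.Adm x := mem_admSet.1 hx
      have hxW : x ≠ .W := fun e => hW (e ▸ hx')
      rw [hG]
      beta_reduce
      rw [if_neg (show ¬((ω.ext hf' x).1 = Side.W ∧ (ω.ext hf' x).2.kindsIn f = []) from
        fun hc => hxW ((ext_fst hf' h hx').symm.trans hc.1))]
  rw [hinner]
  by_cases hK' : ω.2.kindsIn (east f) = []
  · have hno : ∀ i < ω.2.arcs.length, arcFace (ω.2.nth i, ω.2.nth (i + 1)) ≠ some (east f) :=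
      no_arc_of_kindsIn_eq_nil ω.2 hK'
    by_cases hp : ω.1 = .W
    · -- the arrival came through the shared side itself: no extension back into it, no outside row
      have hnA : ¬ω.Adm .W := fun hx => hx.1 hp.symm
      rw [if_neg hnA, if_neg (show ¬(ω.2.kindsIn (east f) = [] ∧ ω.1 ≠ Side.W) from fun hc => hc.2 hp)]
    · have hA : ω.Adm .W := adm_of_no_arc hf' ha h hno (Ne.symm hp)
      obtain ⟨-, hwt⟩ := hextW hA
      rw [hK', List.nil_append, locW_single] at hwt
      rw [if_pos hA, if_pos (show ω.2.kindsIn (east f) = [] ∧ ω.1 ≠ Side.W from ⟨hK', hp⟩)]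
      by_cases hK : (ω.ext hf' .W).2.kindsIn f = []
      · rw [if_pos hK, hwt]; ring
      · -- the extended walk had crossed `f` before reaching the shared side: a return, weight `0`
        rw [if_neg hK]
        have hδ1 : (ω.ext hf' .W).1 = .W := (hextW hA).1
        have hz : (east f).side (ω.ext hf' .W).1 = f.side .E := by rw [hδ1]; rfl
        set δ := (ω.ext hf' .W).2 with hδ
        -- `δ'`: the extended walk as an arrival at `f` labelled `E`
        have hδ'arcs : (δ.cast rfl hz).arcs = δ.arcs := by
          show arcsOf (δ.cast rfl hz).mids = arcsOf δ.mids
          rw [YBWalk.cast_mids]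
        have hδ'nth : ∀ i, (δ.cast rfl hz).nth i = δ.nth i := by
          intro i
          rw [YBWalk.nth, YBWalk.cast_mids, ← YBWalk.nth]
        have hδ'K : (δ.cast rfl hz).kindsIn f = δ.kindsIn f := by
          rw [YBWalk.kindsIn_eq, YBWalk.kindsIn_eq, hδ'arcs]
        have hlen : δ.arcs.length = ω.2.arcs.length + 1 := ext_snd_length hf' h hA
        have hlast : ¬ΩF.IsExt (⟨.E, δ.cast rfl hz⟩ : ΩF Dl a f) := by
          rintro ⟨hn, hface⟩
          simp only at hface
          rw [hδ'arcs, hδ'nth, hlen, Nat.add_sub_cancel, hδ, ext_snd_nth hf' h hA le_rfl,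
            YBWalk.nth_length] at hface
          have hfa : arcFace ((east f).side ω.1, (east f).side .W) = some (east f) :=
            arcFace_side_side (east f) ω.1 .W (Ne.symm hA.1)
          have hfe : east f = f := Option.some_injective _ (hfa.symm.trans hface)
          have := congrArg Prod.fst hfe
          simp [east] at this
        have hncf : ¬CornerFree δ := by
          intro hcf
          have hcf' : CornerFree (δ.cast rfl hz) := by
            intro i hi
            rw [hδ'nth, hδ'nth]
            exact hcf i (by rw [← hδ'arcs]; exact hi)
          have hno := no_arc_of_cornerFree ⟨.E, δ.cast rfl hz⟩ hlast hcf'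
          apply hK
          rw [← hδ'K]
          exact kindsIn_eq_nil_of_no_arc _ hno
        have hw0 : wt W t δ = 0 := by rw [wt, weightL_eq_zero_of_not_cornerFree h1 δ hncf, zero_mul]
        rw [hw0] at hwt
        linear_combination hwt
  · -- the arrival had crossed `f⁺` before: its extension is a return, weight `0`
    rw [if_neg (show ¬(ω.2.kindsIn (east f) = [] ∧ ω.1 ≠ Side.W) from fun hc => hK' hc.1)]
    by_cases hA : ω.Adm .W
    · rw [if_pos hA]
      split_ifs with hK
      · have hncf0 : ¬CornerFree ω.2 := by
          intro hcf
          apply hK'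
          exact kindsIn_eq_nil_of_no_arc ω.2 (no_arc_of_cornerFree ω h hcf)
        have hncf : ¬CornerFree (ω.ext hf' .W).2 := by
          intro hcf
          apply hncf0
          intro i hi
          have hlen := ext_snd_length hf' h hA
          have := hcf i (by rw [hlen]; omega)
          rwa [ext_snd_nth hf' h hA (by omega), ext_snd_nth hf' h hA (by omega)] at this
        rw [wt, weightL_eq_zero_of_not_cornerFree h1 _ hncf, zero_mul]
      · rfl
    · rw [if_neg hA]

/-! ### The domino identity on the branch `u₁ = 0` -/

variable {c : Fin 7 → ℂ}

/-- ★★ **Sufficiency on the whole branch `u₁ = 0`** (ANY `u₂, v, w₁, w₂ ∈ ℂ`, any phase `t ≠ 0`): every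
coefficient vector `c ∈ ℂ⁷` whose six two-plaquette rows vanish is an exact DOMINO relation at every
horizontal domino of every finite face list for every boundary root (hole roots included). Proof: split
the domino functional as `VF_f(dressL c) + VF_{f⁺}(c_E⁺, c_N⁺, γ₂, c_S⁺)` with `γ₂ = c_sh − innerR`; by the
fresh-arrival rows the outside arrivals at `f` and at `f⁺` carry the six rows (zero), the arrivals at
`f⁺` through the shared side carry the row `γ₂ + innerR − c_sh = 0`, and the arrivals at `f` through the
shared side carry `innerL − γ₂` — which the transfer identity `sum_fresh_shared_eq` cancels against the
`(γ₂ − innerL)`-dressed outside arrivals at `f⁺`. [cite: Glazman2015WeightedSAW, Lemma 3.1 (proof: grouping of walks at a rhombus; here at a pair of rhombi)] [cite: JansevanRensburg2015, §4.6 (Temperley method: local linear recursions for partially directed walks)] -/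
theorem exactDominoVertexRelation_of_dominoRows (ht : t ≠ 0) (h1 : W.u₁ = 0) (hrows : DominoRows W t c) :
    ExactDominoVertexRelation W t c := by
  classical
  intro Dl a f hf hf' ha
  obtain ⟨rW, rN, rS, rE', rN', rS'⟩ := hrows
  set γ₂ := c 3 - innerR W t c with hγ₂
  have hsplit : innerR W t c + γ₂ = c 3 := by rw [hγ₂]; ring
  have hLc : leftCoeff c (innerR W t c) = dressL W t c := rfl
  rw [dominoFunctional_eq_add W t c Dl a f hsplit, hLc,
    vertexFunctional_eq_sum_freshRow ht h1 (dressL W t c) hf ha,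
    vertexFunctional_eq_sum_freshRow ht h1 (rightCoeff c γ₂) hf' ha]
  -- at `f`: only the fresh arrivals through the shared side survive, with the row `plaqRow (dressL c) E`
  have eL : (∑ ω ∈ setArr Dl a f, if ω.2.kindsIn f = [] then
      extW W ω.2 f * t ^ quarterTurnsL ω.2.mids * plaqRow W t (dressL W t c) ω.1 else 0) =
      plaqRow W t (dressL W t c) .E * ∑ ω ∈ setArr Dl a f, if ω.2.kindsIn f = [] ∧ ω.1 = .E then
        extW W ω.2 f * t ^ quarterTurnsL ω.2.mids else 0 := by
    rw [Finset.mul_sum]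
    refine Finset.sum_congr rfl fun ω _ => ?_
    obtain ⟨s, γ⟩ := ω
    dsimp only
    by_cases hK : γ.kindsIn f = []
    · rw [if_pos hK]
      by_cases hp : s = .E
      · subst hp
        rw [if_pos (show γ.kindsIn f = [] ∧ Side.E = Side.E from ⟨hK, rfl⟩)]; ring
      · rw [if_neg (show ¬(γ.kindsIn f = [] ∧ s = Side.E) from fun hc => hp hc.2), mul_zero]
        have h0 : plaqRow W t (dressL W t c) s = 0 := by
          cases s
          · exact rW
          · exact absurd rfl hp
          · exact rS
          · exact rN
        rw [h0, mul_zero]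
    · rw [if_neg hK, if_neg (show ¬(γ.kindsIn f = [] ∧ s = Side.E) from fun hc => hK hc.1), mul_zero]
  -- at `f⁺`: the arrivals through the shared side carry the row `0`; the outside arrivals carry
  -- `(γ₂ − innerL) ×` (one-arc weight into the shared side)
  have rowR : ∀ p : Side, plaqRow W t (rightCoeff c γ₂) p =
      plaqRow W t (dressR W t c) p + (γ₂ - innerL W t c) * (arcW W (arcKind p .W) * t ^ qTurn p .W) := by
    intro p
    rw [plaqRow_eq, plaqRow_eq]
    simp only [rightCoeff, dressR, Matrix.cons_val_zero, Matrix.cons_val_one, Matrix.head_cons,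
      Matrix.cons_val_two, Matrix.tail_cons, Matrix.cons_val_three]
    ring
  have rowRW : plaqRow W t (rightCoeff c γ₂) .W = 0 := by
    have e1 := plaqRow_eq W t (rightCoeff c γ₂) .W
    have e2 := plaqRow_eq W t ![c 6, c 4, c 3, c 5] .W
    rw [e1, hγ₂, innerR, e2]
    simp only [rightCoeff, Matrix.cons_val_zero, Matrix.cons_val_one, Matrix.head_cons,
      Matrix.cons_val_two, Matrix.tail_cons, Matrix.cons_val_three, arcKind, arcW, qTurn, zpow_zero]
    ring
  have eR : (∑ ω ∈ setArr Dl a (east f), if ω.2.kindsIn (east f) = [] then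
      extW W ω.2 (east f) * t ^ quarterTurnsL ω.2.mids * plaqRow W t (rightCoeff c γ₂) ω.1 else 0) =
      (γ₂ - innerL W t c) * ∑ ω ∈ setArr Dl a (east f), if ω.2.kindsIn (east f) = [] ∧ ω.1 ≠ .W then
        extW W ω.2 (east f) * t ^ quarterTurnsL ω.2.mids * (arcW W (arcKind ω.1 .W) * t ^ qTurn ω.1 .W)
        else 0 := by
    rw [Finset.mul_sum]
    refine Finset.sum_congr rfl fun ω _ => ?_
    obtain ⟨s, γ⟩ := ω
    dsimp only
    by_cases hK : γ.kindsIn (east f) = []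
    · rw [if_pos hK]
      by_cases hp : s = .W
      · subst hp
        rw [if_neg (show ¬(γ.kindsIn (east f) = [] ∧ Side.W ≠ Side.W) from fun hc => hc.2 rfl), rowRW,
          mul_zero, mul_zero]
      · rw [if_pos (show γ.kindsIn (east f) = [] ∧ s ≠ Side.W from ⟨hK, hp⟩), rowR s]
        have h0 : plaqRow W t (dressR W t c) s = 0 := by
          cases s
          · exact absurd rfl hp
          · exact rE'
          · exact rS'
          · exact rN'
        rw [h0, zero_add]
        ring
    · rw [if_neg hK, if_neg (show ¬(γ.kindsIn (east f) = [] ∧ s ≠ Side.W) from fun hc => hK hc.1),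
        mul_zero]
  have rowLE : plaqRow W t (dressL W t c) .E = innerL W t c - γ₂ := by
    have e1 := plaqRow_eq W t (dressL W t c) .E
    have e2 := plaqRow_eq W t ![c 3, c 1, c 0, c 2] .E
    rw [e1, hγ₂, innerL, e2]
    simp only [dressL, Matrix.cons_val_zero, Matrix.cons_val_one, Matrix.head_cons,
      Matrix.cons_val_two, Matrix.tail_cons, Matrix.cons_val_three, arcKind, arcW, qTurn, zpow_zero]
    ring
  rw [eL, eR, rowLE, sum_fresh_shared_eq ht h1 hf hf' ha]
  ring

/-- ★★ **The domino identity on the directed branch**: for EVERY `u₂, v, w₁, w₂ ∈ ℂ` and every phase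
`t ≠ 0`, the weight system `(0, u₂, v, w₁, w₂)` satisfies the exact two-plaquette relation with the
closed-form vector `branchDominoCoeff u₂ v t = (vK₊, −u₂tK₋, −2u₂vt, K₋K₊, −2u₂vt, −u₂tK₋, vK₊)` at every
horizontal domino of every finite face list for every boundary root, hole roots included — although off
the quartic `(1 ± v)² = u₂²` NO one-plaquette relation exists there
(`PlaquetteWalkCornerBranchClassification_holds`). [cite: GlazmanManolescu2019, Lemma 2.1 (shape of a local relation)] [cite: JansevanRensburg2015, §4.6 (Temperley method for partially directed walks)] -/
theorem exactDominoVertexRelation_branch (W : CWeights) {t : ℂ} (ht : t ≠ 0) (h1 : W.u₁ = 0) :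
    ExactDominoVertexRelation W t (branchDominoCoeff W.u₂ W.v t) :=
  exactDominoVertexRelation_of_dominoRows ht h1 (dominoRows_branchDominoCoeff ht h1)

/-- ★ **Domino class ⊋ plaquette class, witnessed**: at `W = (0, u₂, v, w₁, w₂)` off the quartic
`(1+v−u₂)(1+v+u₂)(1−v−u₂)(1−v+u₂) = 0` and off the two quartic points, there is a nonzero exact domino
relation (this file) but NO nonzero exact one-plaquette relation
(`exactPlaquetteVertexRelation_iff_quartic_of_u₁_eq_zero`, tree). [cite: Glazman2015WeightedSAW, Lemma 3.1 (the one-plaquette weight classification)] -/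
theorem domino_not_plaquette (W : CWeights) {t : ℂ} (ht : t ≠ 0) (h1 : W.u₁ = 0)
    (hq : (1 + W.v - W.u₂) * (1 + W.v + W.u₂) * (1 - W.v - W.u₂) * (1 - W.v + W.u₂) ≠ 0) :
    (∃ c : Fin 7 → ℂ, c ≠ 0 ∧ ExactDominoVertexRelation W t c) ∧
      ¬∃ c : Fin 4 → ℂ, c ≠ 0 ∧ ExactPlaquetteVertexRelation W t c := by
  refine ⟨⟨branchDominoCoeff W.u₂ W.v t, branchDominoCoeff_ne_zero ht ?_,
    exactDominoVertexRelation_branch W ht h1⟩, ?_⟩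
  · rintro (⟨hv, hu⟩ | ⟨hu, hv⟩)
    · apply hq; rw [hv]
      have : W.u₂ ^ 2 - 1 = 0 := by rw [hu]; ring
      linear_combination (W.u₂ ^ 2 - 1) * this
    · apply hq; rw [hu]
      have : W.v ^ 2 - 1 = 0 := by rw [hv]; ring
      linear_combination (W.v ^ 2 - 1) * this
  · rw [exactPlaquetteVertexRelation_iff_quartic_of_u₁_eq_zero W ht h1]
    exact hq

end Branch
/-! ## The mirror branch `u₂ = 0`

The same three steps with co-corners: on `u₂ = 0` every walk of nonzero weight is co-corner-free
(`exists_kindsIn_eq_coCorner`), hence never returns (`ΩF.no_arc_of_coCornerFree`). The rows now keep the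
corner turns `u₁ t^{±1}`; the closed-form vector is `branchDominoCoeffMirror`. -/

section MirrorBranch

open ΩF

open private ext_fst ext_snd_arcs ext_snd_nth ext_snd_length mem_admSet adm_of_no_arc ends_ne_of_arc side_five
  arcKind_self qTurn_self quarterTurnsL_of_snoc qTurnOf_side_side kindsIn_eq_filterMap_filter
  from Literature.Barriers.CriticalPhenomena.PlaquetteWalkDegenerateIdentity

variable {D : Set Face} {a z : MidEdge} {Dl : List Face} {f₀ : Face} {W : CWeights} {t : ℂ}

/-- On `u₂ = 0` a walk that is not co-corner-free weighs `0` (`exists_kindsIn_eq_coCorner`).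
[cite: GlazmanManolescu2019, §1, Fig. 1, eq. (1) (one co-corner arc weighs u₂)] -/
theorem weightL_eq_zero_of_not_coCornerFree (h2 : W.u₂ = 0) (γ : YBWalk D a z) (h : ¬CoCornerFree γ) :
    weightL W γ.mids = 0 := by
  simp only [CoCornerFree, not_forall, not_not, exists_prop] at h
  obtain ⟨j, hj, hkj⟩ := h
  obtain ⟨g, hg⟩ := exists_kindsIn_eq_coCorner γ hj hkj
  rw [weightL_eq_extW_mul W γ g, hg, locW_single, arcW, h2, mul_zero]

/-- ★ **Fresh-arrival rows on the mirror branch `u₂ = 0`** (the same statement; co-corner-free walks):: for ANY coefficient vector the vertex functional at `f₀` is the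
sum, over the arrival walks at `f₀` that have not crossed `f₀` before, of
(exterior weight) × (phase) × (plaquette row of the arrival side). Groups of returning arrivals vanish:
a returning walk is not corner-free, so some plaquette other than `f₀` carries a single corner arc and
weighs `u₁ = 0`. (The proof of `exactPlaquetteVertexRelation_of_u₁_eq_zero`, with the row kept.)
[cite: Glazman2015WeightedSAW, Lemma 3.1 (proof: the one-visit group, eq. (3.11))] -/
theorem vertexFunctional_eq_sum_freshRow_mirror (ht : t ≠ 0) (h2 : W.u₂ = 0) (c : Fin 4 → ℂ) (hf : f₀ ∈ Dl)
    (ha : IsBoundaryRoot Dl a) :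
    vertexFunctional W t c Dl a f₀ = ∑ ω ∈ setArr Dl a f₀,
      if ω.2.kindsIn f₀ = [] then extW W ω.2 f₀ * t ^ quarterTurnsL ω.2.mids * plaqRow W t c ω.1 else 0 := by
  rw [vertexFunctional_eq_sum_term, sum_eq_sum_bracket hf]
  refine Finset.sum_congr rfl fun ω hω => ?_
  have h : ¬ω.IsExt := by simpa [setArr] using hω
  set p := ω.1 with hp
  set E := extW W ω.2 f₀ with hE
  set T := t ^ quarterTurnsL ω.2.mids with hT
  have hself : term W t c ω = c (slotIdx p) * (E * locW W (ω.2.kindsIn f₀) * T) := by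
    rw [term, weightL_eq_extW_mul]
  have hext : ∀ x ∈ ω.admSet, term W t c (ω.ext hf x) =
      E * T * (c (slotIdx x) * locW W (ω.2.kindsIn f₀ ++ [arcKind p x]) * t ^ qTurn p x) := by
    intro x hx
    have hx' : ω.Adm x := mem_admSet.1 hx
    have harcs := ext_snd_arcs hf h hx'
    have hpx : p ≠ x := Ne.symm hx'.1
    have hfa : arcFace (f₀.side p, f₀.side x) = some f₀ := arcFace_side_side f₀ p x hpx
    rw [term, weightL_eq_extW_mul W _ f₀, extW_of_snoc W ω.2 _ f₀ harcs hfa,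
      YBWalk.kindsIn_of_snoc ω.2 _ f₀ harcs hfa, arcKindOf_eq hfa rfl rfl,
      quarterTurnsL_of_snoc ω.2 _ harcs, qTurnOf_side_side f₀ hpx, zpow_add₀ ht, ext_fst hf h hx']
    simp only [List.reduceOption_cons_of_some, List.reduceOption_nil]
    ring
  have hextE : ∀ x ∈ ω.admSet, ∀ g, g ≠ f₀ → (ω.ext hf x).2.kindsIn g = ω.2.kindsIn g := by
    intro x hx g hg
    have hx' : ω.Adm x := mem_admSet.1 hx
    exact YBWalk.kindsIn_of_snoc_of_ne ω.2 _ f₀ (ext_snd_arcs hf h hx')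
      (arcFace_side_side f₀ p x (Ne.symm hx'.1)) hg
  rw [hself, Finset.sum_congr rfl hext, ← Finset.mul_sum]
  have hfilt : ∀ {i : ℕ}, i < ω.2.arcs.length → arcFace (ω.2.nth i, ω.2.nth (i + 1)) = some f₀ →
      (ω.2.nth i, ω.2.nth (i + 1)) ∈ (arcsOf ω.2.mids).filter fun q => arcFace q = some f₀ :=
    fun hi e => List.mem_filter.2 ⟨ω.2.arc_nth_mem hi, by simpa using e⟩
  rcases filter_face_cases ω.2 f₀ with h0 | ⟨q₁, hq1, hq₁⟩ | ⟨q₁, q₂, h2, hne, hq₁, hq₂, -⟩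
  · -- fresh plaquette: the row of the arrival side
    have hK : ω.2.kindsIn f₀ = [] := by rw [kindsIn_eq_filterMap_filter, h0]; rfl
    have hno : ∀ i < ω.2.arcs.length, arcFace (ω.2.nth i, ω.2.nth (i + 1)) ≠ some f₀ := by
      intro i hi e
      have := hfilt hi e
      rw [h0] at this
      simp at this
    have hadm : ω.admSet = Finset.univ.erase p := by
      ext x
      simp only [mem_admSet, Finset.mem_erase, Finset.mem_univ, and_true]
      exact ⟨fun hx => hx.1, fun hx => adm_of_no_arc hf ha h hno hx⟩
    rw [hK, hadm, if_pos rfl, plaqRow, ← Finset.add_sum_erase _ _ (Finset.mem_univ p), arcKind_self,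
      qTurn_self]
    simp only [List.nil_append, locW_single, locW_nil, arcW, zpow_zero, mul_one]
    ring
  · -- one earlier arc `q₁` in `f₀`, at index `i`: the group vanishes
    have hq₁m : q₁ ∈ ω.2.arcs := by
      have : q₁ ∈ (arcsOf ω.2.mids).filter fun q => arcFace q = some f₀ := by rw [hq1]; simp
      exact (List.mem_filter.1 this).1
    obtain ⟨s₁, s₂, h12, hs₁, hs₂, hk⟩ := exists_sides_of_arcFace hq₁
    obtain ⟨i, hi, hqi⟩ := (ω.2.mem_arcs_iff_nth).1 hq₁m
    have hK : ω.2.kindsIn f₀ = [arcKind s₁ s₂] := by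
      rw [kindsIn_eq_filterMap_filter, hq1, List.filterMap_cons, hk, List.filterMap_nil]
    rw [hK, if_neg (List.cons_ne_nil _ _)]
    by_cases hkc : arcKind s₁ s₂ = .coCorner
    · have hE0 : ∀ x ∈ ω.admSet, E = 0 := by
        intro x hx
        have hx' : ω.Adm x := mem_admSet.1 hx
        have harcs := ext_snd_arcs hf h hx'
        have hq₁m' : q₁ ∈ (ω.ext hf x).2.arcs := by rw [harcs]; exact List.mem_append_left _ hq₁m
        obtain ⟨g, hg⟩ := exists_kindsIn_eq_coCorner_of_mem _ hq₁m' (by rw [hk, hkc])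
        have hfa : arcFace (f₀.side p, f₀.side x) = some f₀ := arcFace_side_side f₀ p x (Ne.symm hx'.1)
        have hgf : g ≠ f₀ := by
          intro e
          rw [e, YBWalk.kindsIn_of_snoc ω.2 _ f₀ harcs hfa, hK, arcKindOf_eq hfa rfl rfl] at hg
          simp at hg
        rw [hextE x hx g hgf] at hg
        exact extW_eq_zero_of_kindsIn_coCorner h2 ω.2 hg hgf
      rw [hkc]
      have hu : locW W [ArcKind.coCorner] = 0 := by rw [locW_single, arcW, h2]
      rw [hu]
      by_cases hne : ω.admSet = ∅
      · rw [hne, Finset.sum_empty]; ring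
      · obtain ⟨x, hx⟩ := Finset.nonempty_iff_ne_empty.2 hne
        rw [hE0 x hx]; ring
    · have hncf : ¬CoCornerFree ω.2 := fun hcf =>
        no_arc_of_coCornerFree ω h hcf i hi (by rw [← hqi]; exact hq₁)
      simp only [CoCornerFree, not_forall, not_not, exists_prop] at hncf
      obtain ⟨j, hj, hkj⟩ := hncf
      obtain ⟨g, hg⟩ := exists_kindsIn_eq_coCorner ω.2 hj hkj
      have hgf : g ≠ f₀ := by
        rintro rfl
        rw [hK] at hg
        exact hkc (List.singleton_injective hg)
      have hE0 : E = 0 := extW_eq_zero_of_kindsIn_coCorner h2 ω.2 hg hgf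
      rw [hE0]
      ring
  · -- two arcs in `f₀`: impossible for an arrival
    exfalso
    have hm : ∀ q, q ∈ [q₁, q₂] → q ∈ ω.2.arcs := by
      intro q hq
      have : q ∈ (arcsOf ω.2.mids).filter fun q => arcFace q = some f₀ := by rw [h2]; exact hq
      exact (List.mem_filter.1 this).1
    have hq₁m := hm q₁ (by simp)
    have hq₂m := hm q₂ (by simp)
    obtain ⟨e11, e12, e21, e22⟩ := arcs_ends_ne ω.2 hq₁m hq₂m hne hq₁ hq₂
    obtain ⟨s₁, s₂, h12, hs₁, hs₂, -⟩ := exists_sides_of_arcFace hq₁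
    obtain ⟨s₃, s₄, h34, hs₃, hs₄, -⟩ := exists_sides_of_arcFace hq₂
    obtain ⟨i, hi, hqi⟩ := (ω.2.mem_arcs_iff_nth).1 hq₁m
    obtain ⟨j, hj, hqj⟩ := (ω.2.mem_arcs_iff_nth).1 hq₂m
    obtain ⟨hne₁, hne₂⟩ := ends_ne_of_arc h hi (by rw [← hqi]; exact hq₁)
    obtain ⟨hne₃, hne₄⟩ := ends_ne_of_arc h hj (by rw [← hqj]; exact hq₂)
    rw [hqi] at hs₁ hs₂
    rw [hqj] at hs₃ hs₄
    rw [hqi, hqj] at e11 e12 e21 e22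
    simp only at hs₁ hs₂ hs₃ hs₄ e11 e12 e21 e22
    rw [← hs₁] at e11 e12 hne₁
    rw [← hs₂] at e21 e22 hne₂
    rw [← hs₃] at e11 e21 hne₃
    rw [← hs₄] at e12 e22 hne₄
    have n13 : s₁ ≠ s₃ := fun e => e11 (by rw [e])
    have n14 : s₁ ≠ s₄ := fun e => e12 (by rw [e])
    have n23 : s₂ ≠ s₃ := fun e => e21 (by rw [e])
    have n24 : s₂ ≠ s₄ := fun e => e22 (by rw [e])
    have n1 : ω.1 ≠ s₁ := fun e => hne₁ (by rw [e])
    have n2 : ω.1 ≠ s₂ := fun e => hne₂ (by rw [e])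
    have n3 : ω.1 ≠ s₃ := fun e => hne₃ (by rw [e])
    have n4 : ω.1 ≠ s₄ := fun e => hne₄ (by rw [e])
    exact side_five h12 n13 n14 n23 n24 h34 n1 n2 n3 n4

variable {f : Face}

/-- ★ **Transfer through the shared side** (`u₂ = 0`; the same statement): the fresh arrivals at `f` through its east side,
weighted by exterior weight × phase, equal the fresh OUTSIDE arrivals at `f⁺`, weighted by exterior
weight × phase × (one-arc weight into the west side of `f⁺`). Mechanism: the former are exactly the
one-arc extensions into the shared side of the latter (the `base`/`ext` bijection of the grouping at
`f⁺`); an extension that had crossed `f` before, or whose arrival had crossed `f⁺` before, is a returning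
walk, not corner-free, of weight `0`. [cite: Glazman2015WeightedSAW, Lemma 3.1 (proof: walks in a group differ only inside the rhombus)] -/
theorem sum_fresh_shared_eq_mirror (ht : t ≠ 0) (h2 : W.u₂ = 0) (hf : f ∈ Dl) (hf' : east f ∈ Dl)
    (ha : IsBoundaryRoot Dl a) :
    (∑ ω ∈ setArr Dl a f, if ω.2.kindsIn f = [] ∧ ω.1 = .E then extW W ω.2 f * t ^ quarterTurnsL ω.2.mids
      else 0) =
    ∑ ω ∈ setArr Dl a (east f), if ω.2.kindsIn (east f) = [] ∧ ω.1 ≠ .W then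
      extW W ω.2 (east f) * t ^ quarterTurnsL ω.2.mids * (arcW W (arcKind ω.1 .W) * t ^ qTurn ω.1 .W)
      else 0 := by
  classical
  -- Step 1: the left side as a sum over all walks ending at the shared side
  have hL : (∑ ω ∈ setArr Dl a f, if ω.2.kindsIn f = [] ∧ ω.1 = .E then
      extW W ω.2 f * t ^ quarterTurnsL ω.2.mids else 0) =
      ∑ γ : YBWalk (dom Dl) a (f.side .E), if γ.kindsIn f = [] then wt W t γ else 0 := by
    have e1 : (∑ ω ∈ setArr Dl a f, if ω.2.kindsIn f = [] ∧ ω.1 = .E then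
        extW W ω.2 f * t ^ quarterTurnsL ω.2.mids else 0) =
        ∑ ω : ΩF Dl a f, if ω.2.kindsIn f = [] ∧ ω.1 = .E then wt W t ω.2 else 0 := by
      rw [setArr, Finset.sum_filter]
      refine Finset.sum_congr rfl fun ω _ => ?_
      by_cases hc : ω.2.kindsIn f = [] ∧ ω.1 = .E
      · obtain ⟨s, γ⟩ := ω
        obtain ⟨hK, hs⟩ := hc
        simp only at hs
        subst hs
        rw [if_pos (not_isExt_of_kindsIn_eq_nil γ hK), if_pos (show γ.kindsIn f = [] ∧ Side.E = Side.E from ⟨hK, rfl⟩),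
          if_pos (show γ.kindsIn f = [] ∧ Side.E = Side.E from ⟨hK, rfl⟩), wt,
          weightL_eq_extW_mul W γ f, hK, locW_nil, mul_one]
      · rw [if_neg hc]
        split_ifs <;> rfl
    rw [e1, Fintype.sum_sigma]
    rw [Fintype.sum_eq_single Side.E (fun s hs => by
      refine Finset.sum_eq_zero fun γ _ => ?_
      rw [if_neg (fun hc => hs hc.2)])]
    refine Finset.sum_congr rfl fun γ _ => ?_
    by_cases hK : γ.kindsIn f = []
    · rw [if_pos (show γ.kindsIn f = [] ∧ Side.E = Side.E from ⟨hK, rfl⟩), if_pos hK]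
    · rw [if_neg (show ¬(γ.kindsIn f = [] ∧ Side.E = Side.E) from fun hc => hK hc.1), if_neg hK]
  -- Step 2: the same sum through the extension class at `f⁺`
  set G : ΩF Dl a (east f) → ℂ := fun ω => if ω.1 = .W ∧ ω.2.kindsIn f = [] then wt W t ω.2 else 0
    with hG
  have hLM : (∑ γ : YBWalk (dom Dl) a (f.side .E), if γ.kindsIn f = [] then wt W t γ else 0) =
      ∑ γ : YBWalk (dom Dl) a ((east f).side .W), if γ.kindsIn f = [] then wt W t γ else 0 := rfl
  have hM : (∑ γ : YBWalk (dom Dl) a ((east f).side .W), if γ.kindsIn f = [] then wt W t γ else 0) =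
      ∑ ω ∈ setExt Dl a (east f), G ω := by
    rw [setExt, Finset.sum_filter, Fintype.sum_sigma]
    rw [Fintype.sum_eq_single Side.W (fun s hs => by
      refine Finset.sum_eq_zero fun γ _ => ?_
      rw [hG]
      beta_reduce
      rw [if_neg (show ¬(s = Side.W ∧ γ.kindsIn f = []) from fun hc => hs hc.1)]
      split_ifs <;> rfl)]
    refine Finset.sum_congr rfl fun γ _ => ?_
    rw [hG]
    beta_reduce
    by_cases hK : γ.kindsIn f = []
    · rw [if_pos hK, if_pos (isExt_east_of_kindsIn_eq_nil hf hf' ha γ hK),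
        if_pos (show Side.W = Side.W ∧ γ.kindsIn f = [] from ⟨rfl, hK⟩)]
    · rw [if_neg hK]
      split_ifs with h1' h2'
      · exact absurd h2'.2 hK
      · rfl
      · rfl
  rw [hL, hLM, hM, sum_ext hf' G]
  -- Step 3: compare group by group over the arrivals at `f⁺`
  refine Finset.sum_congr rfl fun ω hω => ?_
  have h : ¬ω.IsExt := by simpa [setArr] using hω
  -- the extension into the shared side, when admissible: its label, weight and corner-freeness
  have hextW : ω.Adm .W → (ω.ext hf' .W).1 = .W ∧
      wt W t (ω.ext hf' .W).2 = extW W ω.2 (east f) * locW W (ω.2.kindsIn (east f) ++ [arcKind ω.1 .W]) *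
        (t ^ quarterTurnsL ω.2.mids * t ^ qTurn ω.1 .W) := by
    intro hx
    have harcs := ext_snd_arcs hf' h hx
    have hpx : ω.1 ≠ .W := Ne.symm hx.1
    have hfa : arcFace ((east f).side ω.1, (east f).side .W) = some (east f) :=
      arcFace_side_side (east f) ω.1 .W hpx
    refine ⟨ext_fst hf' h hx, ?_⟩
    rw [wt, weightL_eq_extW_mul W _ (east f), extW_of_snoc W ω.2 _ (east f) harcs hfa,
      YBWalk.kindsIn_of_snoc ω.2 _ (east f) harcs hfa, arcKindOf_eq hfa (s := ω.1) (t := Side.W) rfl rfl,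
      quarterTurnsL_of_snoc ω.2 _ harcs, qTurnOf_side_side (east f) hpx, zpow_add₀ ht]
    simp only [List.reduceOption_cons_of_some, List.reduceOption_nil]
  -- the inner sum over the admissible sides is the single term `x = W` (if admissible)
  have hinner : (∑ x ∈ ω.admSet, G (ω.ext hf' x)) =
      if ω.Adm .W then (if (ω.ext hf' .W).2.kindsIn f = [] then wt W t (ω.ext hf' .W).2 else 0) else 0 := by
    by_cases hW : ω.Adm .W
    · rw [if_pos hW, Finset.sum_eq_single_of_mem Side.W (mem_admSet.2 hW) (fun x hx hxW => by
        have hx' : ω.Adm x := mem_admSet.1 hx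
        rw [hG]
        beta_reduce
        rw [if_neg (show ¬((ω.ext hf' x).1 = Side.W ∧ (ω.ext hf' x).2.kindsIn f = []) from
          fun hc => hxW ((ext_fst hf' h hx').symm.trans hc.1))])]
      rw [hG]
      beta_reduce
      have hδ1 : (ω.ext hf' .W).1 = .W := (hextW hW).1
      by_cases hK : (ω.ext hf' .W).2.kindsIn f = []
      · rw [if_pos (show (ω.ext hf' Side.W).1 = Side.W ∧ (ω.ext hf' Side.W).2.kindsIn f = [] from ⟨hδ1, hK⟩),
          if_pos hK]
      · rw [if_neg (show ¬((ω.ext hf' Side.W).1 = Side.W ∧ (ω.ext hf' Side.W).2.kindsIn f = []) from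
          fun hc => hK hc.2), if_neg hK]
    · rw [if_neg hW]
      refine Finset.sum_eq_zero fun x hx => ?_
      have hx' : ω.Adm x := mem_admSet.1 hx
      have hxW : x ≠ .W := fun e => hW (e ▸ hx')
      rw [hG]
      beta_reduce
      rw [if_neg (show ¬((ω.ext hf' x).1 = Side.W ∧ (ω.ext hf' x).2.kindsIn f = []) from
        fun hc => hxW ((ext_fst hf' h hx').symm.trans hc.1))]
  rw [hinner]
  by_cases hK' : ω.2.kindsIn (east f) = []
  · have hno : ∀ i < ω.2.arcs.length, arcFace (ω.2.nth i, ω.2.nth (i + 1)) ≠ some (east f) :=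
      no_arc_of_kindsIn_eq_nil ω.2 hK'
    by_cases hp : ω.1 = .W
    · -- the arrival came through the shared side itself: no extension back into it, no outside row
      have hnA : ¬ω.Adm .W := fun hx => hx.1 hp.symm
      rw [if_neg hnA, if_neg (show ¬(ω.2.kindsIn (east f) = [] ∧ ω.1 ≠ Side.W) from fun hc => hc.2 hp)]
    · have hA : ω.Adm .W := adm_of_no_arc hf' ha h hno (Ne.symm hp)
      obtain ⟨-, hwt⟩ := hextW hA
      rw [hK', List.nil_append, locW_single] at hwt
      rw [if_pos hA, if_pos (show ω.2.kindsIn (east f) = [] ∧ ω.1 ≠ Side.W from ⟨hK', hp⟩)]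
      by_cases hK : (ω.ext hf' .W).2.kindsIn f = []
      · rw [if_pos hK, hwt]; ring
      · -- the extended walk had crossed `f` before reaching the shared side: a return, weight `0`
        rw [if_neg hK]
        have hδ1 : (ω.ext hf' .W).1 = .W := (hextW hA).1
        have hz : (east f).side (ω.ext hf' .W).1 = f.side .E := by rw [hδ1]; rfl
        set δ := (ω.ext hf' .W).2 with hδ
        -- `δ'`: the extended walk as an arrival at `f` labelled `E`
        have hδ'arcs : (δ.cast rfl hz).arcs = δ.arcs := by
          show arcsOf (δ.cast rfl hz).mids = arcsOf δ.mids
          rw [YBWalk.cast_mids]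
        have hδ'nth : ∀ i, (δ.cast rfl hz).nth i = δ.nth i := by
          intro i
          rw [YBWalk.nth, YBWalk.cast_mids, ← YBWalk.nth]
        have hδ'K : (δ.cast rfl hz).kindsIn f = δ.kindsIn f := by
          rw [YBWalk.kindsIn_eq, YBWalk.kindsIn_eq, hδ'arcs]
        have hlen : δ.arcs.length = ω.2.arcs.length + 1 := ext_snd_length hf' h hA
        have hlast : ¬ΩF.IsExt (⟨.E, δ.cast rfl hz⟩ : ΩF Dl a f) := by
          rintro ⟨hn, hface⟩
          simp only at hface
          rw [hδ'arcs, hδ'nth, hlen, Nat.add_sub_cancel, hδ, ext_snd_nth hf' h hA le_rfl,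
            YBWalk.nth_length] at hface
          have hfa : arcFace ((east f).side ω.1, (east f).side .W) = some (east f) :=
            arcFace_side_side (east f) ω.1 .W (Ne.symm hA.1)
          have hfe : east f = f := Option.some_injective _ (hfa.symm.trans hface)
          have := congrArg Prod.fst hfe
          simp [east] at this
        have hncf : ¬CoCornerFree δ := by
          intro hcf
          have hcf' : CoCornerFree (δ.cast rfl hz) := by
            intro i hi
            rw [hδ'nth, hδ'nth]
            exact hcf i (by rw [← hδ'arcs]; exact hi)
          have hno := no_arc_of_coCornerFree ⟨.E, δ.cast rfl hz⟩ hlast hcf'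
          apply hK
          rw [← hδ'K]
          exact kindsIn_eq_nil_of_no_arc _ hno
        have hw0 : wt W t δ = 0 := by rw [wt, weightL_eq_zero_of_not_coCornerFree h2 δ hncf, zero_mul]
        rw [hw0] at hwt
        linear_combination hwt
  · -- the arrival had crossed `f⁺` before: its extension is a return, weight `0`
    rw [if_neg (show ¬(ω.2.kindsIn (east f) = [] ∧ ω.1 ≠ Side.W) from fun hc => hK' hc.1)]
    by_cases hA : ω.Adm .W
    · rw [if_pos hA]
      split_ifs with hK
      · have hncf0 : ¬CoCornerFree ω.2 := by
          intro hcf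
          apply hK'
          exact kindsIn_eq_nil_of_no_arc ω.2 (no_arc_of_coCornerFree ω h hcf)
        have hncf : ¬CoCornerFree (ω.ext hf' .W).2 := by
          intro hcf
          apply hncf0
          intro i hi
          have hlen := ext_snd_length hf' h hA
          have := hcf i (by rw [hlen]; omega)
          rwa [ext_snd_nth hf' h hA (by omega), ext_snd_nth hf' h hA (by omega)] at this
        rw [wt, weightL_eq_zero_of_not_coCornerFree h2 _ hncf, zero_mul]
      · rfl
    · rw [if_neg hA]

variable {c : Fin 7 → ℂ}

/-- ★★ **Sufficiency on the whole mirror branch `u₂ = 0`** (same proof with co-corners): (ANY `u₂, v, w₁, w₂ ∈ ℂ`, any phase `t ≠ 0`): every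
coefficient vector `c ∈ ℂ⁷` whose six two-plaquette rows vanish is an exact DOMINO relation at every
horizontal domino of every finite face list for every boundary root (hole roots included). Proof: split
the domino functional as `VF_f(dressL c) + VF_{f⁺}(c_E⁺, c_N⁺, γ₂, c_S⁺)` with `γ₂ = c_sh − innerR`; by the
fresh-arrival rows the outside arrivals at `f` and at `f⁺` carry the six rows (zero), the arrivals at
`f⁺` through the shared side carry the row `γ₂ + innerR − c_sh = 0`, and the arrivals at `f` through the
shared side carry `innerL − γ₂` — which the transfer identity `sum_fresh_shared_eq` cancels against the
`(γ₂ − innerL)`-dressed outside arrivals at `f⁺`. [cite: Glazman2015WeightedSAW, Lemma 3.1 (proof: grouping of walks at a rhombus; here at a pair of rhombi)] [cite: JansevanRensburg2015, §4.6 (Temperley method: local linear recursions for partially directed walks)] -/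
theorem exactDominoVertexRelation_of_dominoRows_mirror (ht : t ≠ 0) (h2 : W.u₂ = 0) (hrows : DominoRows W t c) :
    ExactDominoVertexRelation W t c := by
  classical
  intro Dl a f hf hf' ha
  obtain ⟨rW, rN, rS, rE', rN', rS'⟩ := hrows
  set γ₂ := c 3 - innerR W t c with hγ₂
  have hsplit : innerR W t c + γ₂ = c 3 := by rw [hγ₂]; ring
  have hLc : leftCoeff c (innerR W t c) = dressL W t c := rfl
  rw [dominoFunctional_eq_add W t c Dl a f hsplit, hLc,
    vertexFunctional_eq_sum_freshRow_mirror ht h2 (dressL W t c) hf ha,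
    vertexFunctional_eq_sum_freshRow_mirror ht h2 (rightCoeff c γ₂) hf' ha]
  -- at `f`: only the fresh arrivals through the shared side survive, with the row `plaqRow (dressL c) E`
  have eL : (∑ ω ∈ setArr Dl a f, if ω.2.kindsIn f = [] then
      extW W ω.2 f * t ^ quarterTurnsL ω.2.mids * plaqRow W t (dressL W t c) ω.1 else 0) =
      plaqRow W t (dressL W t c) .E * ∑ ω ∈ setArr Dl a f, if ω.2.kindsIn f = [] ∧ ω.1 = .E then
        extW W ω.2 f * t ^ quarterTurnsL ω.2.mids else 0 := by
    rw [Finset.mul_sum]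
    refine Finset.sum_congr rfl fun ω _ => ?_
    obtain ⟨s, γ⟩ := ω
    dsimp only
    by_cases hK : γ.kindsIn f = []
    · rw [if_pos hK]
      by_cases hp : s = .E
      · subst hp
        rw [if_pos (show γ.kindsIn f = [] ∧ Side.E = Side.E from ⟨hK, rfl⟩)]; ring
      · rw [if_neg (show ¬(γ.kindsIn f = [] ∧ s = Side.E) from fun hc => hp hc.2), mul_zero]
        have h0 : plaqRow W t (dressL W t c) s = 0 := by
          cases s
          · exact rW
          · exact absurd rfl hp
          · exact rS
          · exact rN
        rw [h0, mul_zero]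
    · rw [if_neg hK, if_neg (show ¬(γ.kindsIn f = [] ∧ s = Side.E) from fun hc => hK hc.1), mul_zero]
  -- at `f⁺`: the arrivals through the shared side carry the row `0`; the outside arrivals carry
  -- `(γ₂ − innerL) ×` (one-arc weight into the shared side)
  have rowR : ∀ p : Side, plaqRow W t (rightCoeff c γ₂) p =
      plaqRow W t (dressR W t c) p + (γ₂ - innerL W t c) * (arcW W (arcKind p .W) * t ^ qTurn p .W) := by
    intro p
    rw [plaqRow_eq, plaqRow_eq]
    simp only [rightCoeff, dressR, Matrix.cons_val_zero, Matrix.cons_val_one, Matrix.head_cons,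
      Matrix.cons_val_two, Matrix.tail_cons, Matrix.cons_val_three]
    ring
  have rowRW : plaqRow W t (rightCoeff c γ₂) .W = 0 := by
    have e1 := plaqRow_eq W t (rightCoeff c γ₂) .W
    have e2 := plaqRow_eq W t ![c 6, c 4, c 3, c 5] .W
    rw [e1, hγ₂, innerR, e2]
    simp only [rightCoeff, Matrix.cons_val_zero, Matrix.cons_val_one, Matrix.head_cons,
      Matrix.cons_val_two, Matrix.tail_cons, Matrix.cons_val_three, arcKind, arcW, qTurn, zpow_zero]
    ring
  have eR : (∑ ω ∈ setArr Dl a (east f), if ω.2.kindsIn (east f) = [] then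
      extW W ω.2 (east f) * t ^ quarterTurnsL ω.2.mids * plaqRow W t (rightCoeff c γ₂) ω.1 else 0) =
      (γ₂ - innerL W t c) * ∑ ω ∈ setArr Dl a (east f), if ω.2.kindsIn (east f) = [] ∧ ω.1 ≠ .W then
        extW W ω.2 (east f) * t ^ quarterTurnsL ω.2.mids * (arcW W (arcKind ω.1 .W) * t ^ qTurn ω.1 .W)
        else 0 := by
    rw [Finset.mul_sum]
    refine Finset.sum_congr rfl fun ω _ => ?_
    obtain ⟨s, γ⟩ := ω
    dsimp only
    by_cases hK : γ.kindsIn (east f) = []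
    · rw [if_pos hK]
      by_cases hp : s = .W
      · subst hp
        rw [if_neg (show ¬(γ.kindsIn (east f) = [] ∧ Side.W ≠ Side.W) from fun hc => hc.2 rfl), rowRW,
          mul_zero, mul_zero]
      · rw [if_pos (show γ.kindsIn (east f) = [] ∧ s ≠ Side.W from ⟨hK, hp⟩), rowR s]
        have h0 : plaqRow W t (dressR W t c) s = 0 := by
          cases s
          · exact absurd rfl hp
          · exact rE'
          · exact rS'
          · exact rN'
        rw [h0, zero_add]
        ring
    · rw [if_neg hK, if_neg (show ¬(γ.kindsIn (east f) = [] ∧ s ≠ Side.W) from fun hc => hK hc.1),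
        mul_zero]
  have rowLE : plaqRow W t (dressL W t c) .E = innerL W t c - γ₂ := by
    have e1 := plaqRow_eq W t (dressL W t c) .E
    have e2 := plaqRow_eq W t ![c 3, c 1, c 0, c 2] .E
    rw [e1, hγ₂, innerL, e2]
    simp only [dressL, Matrix.cons_val_zero, Matrix.cons_val_one, Matrix.head_cons,
      Matrix.cons_val_two, Matrix.tail_cons, Matrix.cons_val_three, arcKind, arcW, qTurn, zpow_zero]
    ring
  rw [eL, eR, rowLE, sum_fresh_shared_eq_mirror ht h2 hf hf' ha]
  ring

/-- ★★ **The domino identity on the mirror branch**: for EVERY `u₁, v, w₁, w₂ ∈ ℂ` and every phase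
`t ≠ 0`, the weight system `(u₁, 0, v, w₁, w₂)` satisfies the exact two-plaquette relation with
`branchDominoCoeffMirror u₁ v t` at every horizontal domino of every finite face list for every boundary
root. [cite: GlazmanManolescu2019, Lemma 2.1 (shape of a local relation)] [cite: JansevanRensburg2015, §4.6 (Temperley method)] -/
theorem exactDominoVertexRelation_mirrorBranch (W : CWeights) {t : ℂ} (ht : t ≠ 0) (h2 : W.u₂ = 0) :
    ExactDominoVertexRelation W t (branchDominoCoeffMirror W.u₁ W.v t) :=
  exactDominoVertexRelation_of_dominoRows_mirror ht h2 (dominoRows_branchDominoCoeffMirror ht h2)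

/-- ★ **Domino class ⊋ plaquette class on the mirror branch too**: at `W = (u₁, 0, v, w₁, w₂)` off the
quartic `(1+v−u₁)(1+v+u₁)(1−v−u₁)(1−v+u₁) = 0` there is a nonzero exact domino relation but NO nonzero
exact one-plaquette relation (`exactPlaquetteVertexRelation_iff_quartic_of_u₂_eq_zero`, tree).
[cite: Glazman2015WeightedSAW, Lemma 3.1 (the one-plaquette weight classification)] -/
theorem domino_not_plaquette_mirror (W : CWeights) {t : ℂ} (ht : t ≠ 0) (h2 : W.u₂ = 0)
    (hq : (1 + W.v - W.u₁) * (1 + W.v + W.u₁) * (1 - W.v - W.u₁) * (1 - W.v + W.u₁) ≠ 0) :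
    (∃ c : Fin 7 → ℂ, c ≠ 0 ∧ ExactDominoVertexRelation W t c) ∧
      ¬∃ c : Fin 4 → ℂ, c ≠ 0 ∧ ExactPlaquetteVertexRelation W t c := by
  refine ⟨⟨branchDominoCoeffMirror W.u₁ W.v t, branchDominoCoeffMirror_ne_zero ht ?_,
    exactDominoVertexRelation_mirrorBranch W ht h2⟩, ?_⟩
  · rintro (⟨hv, hu⟩ | ⟨hu, hv⟩)
    · apply hq; rw [hv]
      have : W.u₁ ^ 2 - 1 = 0 := by rw [hu]; ring
      linear_combination (W.u₁ ^ 2 - 1) * this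
    · apply hq; rw [hu]
      have : W.v ^ 2 - 1 = 0 := by rw [hv]; ring
      linear_combination (W.v ^ 2 - 1) * this
  · rw [exactPlaquetteVertexRelation_iff_quartic_of_u₂_eq_zero W ht h2]
    exact hq

end MirrorBranch

/-! ## Two-sided: the domino class of the branches -/

section TwoSided

variable {W : CWeights} {t : ℂ} {c : Fin 7 → ℂ}

/-- ★★ **Two-sided on the branch `u₁ = 0`**: the domino technique class IS the solution space of the six
two-plaquette rows (every `u₂, v, w₁, w₂ ∈ ℂ`, every phase `t ≠ 0`). [cite: Glazman2015WeightedSAW, Lemma 3.1 (the two-sided one-rhombus classification this extends to two rhombi)] -/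
theorem exactDominoVertexRelation_iff_dominoRows_of_u₁_eq_zero (ht : t ≠ 0) (h1 : W.u₁ = 0) :
    ExactDominoVertexRelation W t c ↔ DominoRows W t c :=
  ⟨fun h => dominoRows_of_exactDominoVertexRelation h ht, exactDominoVertexRelation_of_dominoRows ht h1⟩

/-- ★★ **Two-sided on the mirror branch `u₂ = 0`.** [cite: Glazman2015WeightedSAW, Lemma 3.1 (the two-sided one-rhombus classification this extends to two rhombi)] -/
theorem exactDominoVertexRelation_iff_dominoRows_of_u₂_eq_zero (ht : t ≠ 0) (h2 : W.u₂ = 0) :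
    ExactDominoVertexRelation W t c ↔ DominoRows W t c :=
  ⟨fun h => dominoRows_of_exactDominoVertexRelation h ht,
    exactDominoVertexRelation_of_dominoRows_mirror ht h2⟩


/-- ★★ **The domino technique class of the branch `u₁ = 0`, classified off the quartic**: an exact domino
relation exists with `c` iff `c` is symmetric and solves the three symmetric equations; every such `c` is
proportional to `branchDominoCoeff u₂ v t` (`dominoRows_proportional_of_u₁_eq_zero`), which is itself
exact (`exactDominoVertexRelation_branch`) and nonzero here. [cite: Glazman2015WeightedSAW, Lemma 3.1 (the two-sided one-rhombus classification this extends)] -/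
theorem exactDominoVertexRelation_iff_sym_of_u₁_eq_zero (ht : t ≠ 0) (h1 : W.u₁ = 0)
    (hq : (1 + W.v - W.u₂) * (1 + W.v + W.u₂) * (1 - W.v - W.u₂) * (1 - W.v + W.u₂) ≠ 0) :
    ExactDominoVertexRelation W t c ↔
      (c 6 = c 0 ∧ c 5 = c 1 ∧ c 4 = c 2 ∧ c 2 = -(W.v * c 1) - W.u₂ * t * c 0 ∧
        W.v * c 3 = (W.u₂ ^ 2 - W.v ^ 2 - 1) * c 0 ∧ (W.u₂ ^ 2 - W.v ^ 2 + 1) * c 1 + W.u₂ * t * c 3 = 0) := by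
  rw [exactDominoVertexRelation_iff_dominoRows_of_u₁_eq_zero ht h1, dominoRows_iff_sym_of_u₁_eq_zero ht h1 hq]


/-- ★★ **The domino technique class of the mirror branch `u₂ = 0`, classified off its quartic.**
[cite: Glazman2015WeightedSAW, Lemma 3.1 (the two-sided one-rhombus classification this extends)] -/
theorem exactDominoVertexRelation_iff_sym_of_u₂_eq_zero (ht : t ≠ 0) (h2 : W.u₂ = 0)
    (hq : (1 + W.v - W.u₁) * (1 + W.v + W.u₁) * (1 - W.v - W.u₁) * (1 - W.v + W.u₁) ≠ 0) :
    ExactDominoVertexRelation W t c ↔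
      (c 6 = c 0 ∧ c 5 = c 1 ∧ c 4 = c 2 ∧ c 1 = -(W.v * c 2) - W.u₁ * t⁻¹ * c 0 ∧
        W.v * c 3 = (W.u₁ ^ 2 - W.v ^ 2 - 1) * c 0 ∧ (W.u₁ ^ 2 - W.v ^ 2 + 1) * c 2 + W.u₁ * t⁻¹ * c 3 = 0) := by
  rw [exactDominoVertexRelation_iff_dominoRows_of_u₂_eq_zero ht h2, dominoRows_iff_sym_of_u₂_eq_zero ht h2 hq]

end TwoSided

/-! ## The named statement -/

section Named

/-- **Barrier `PlaquetteWalkDominoIdentity`** (named statement): on BOTH directed branches of the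
five-weight plaquette walk on `ℤ²` — `u₁ = 0` (every `u₂, v, w₁, w₂ ∈ ℂ`) and `u₂ = 0` (every
`u₁, v, w₁, w₂ ∈ ℂ`) — and for every phase `t ≠ 0`, the constant vector `branchDominoCoeff u₂ v t`, resp.
`branchDominoCoeffMirror u₁ v t`, is an exact DOMINO (two-plaquette) vertex relation at every horizontal
domino of every finite face list for every boundary root (hole roots included); each vector is nonzero off
the two quartic points of its branch. A THEOREM of this file (`PlaquetteWalkDominoIdentity_holds`).

BARRIER (structured block, D-0021):
- technique_class: two-plaquette (domino) linear vertex relations `Σ_{s<7} c_s F(z_s) = 0` with a constant `c ∈ ℂ⁷` over the seven sides of two horizontally adjacent plaquettes, for the Glazman–Manolescu plaquette walk on `ℤ²` with complex weights `(u₁, u₂, v, w₁, w₂)` and phase `t ≠ 0` per left quarter turn, at every domino of every finite face list for every boundary root — `ExactDominoVertexRelation W t c`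
- blocks: nothing — it PROVIDES identities: the whole hyperplanes `{u₁ = 0}` and `{u₂ = 0}` carry a nonzero domino relation at every phase, whereas the ONE-plaquette all-roots class meets them only in the quartics `(1 ± v)² = u²` (`PlaquetteWalkCornerBranchClassification`, `PlaquetteWalkMirrorBranchClassification`): the domino technique class is strictly larger than the plaquette class (`domino_not_plaquette`, `domino_not_plaquette_mirror`), by codimension-one components of statistical-mechanically trivial (partially directed) models
- because: on `u₁ = 0` (resp. `u₂ = 0`) every walk of nonzero weight is corner-free (resp. co-corner-free) — no walk doubles all its corner plaquettes, `exists_kindsIn_eq_corner` / `exists_kindsIn_eq_coCorner` — hence directed and never returning (`ΩF.no_arc_of_cornerFree` / `…coCornerFree`); the vertex functional is then the sum of fresh-arrival rows (`vertexFunctional_eq_sum_freshRow`), the arrivals through the shared side are the one-arc extensions of the fresh outside arrivals at the other plaquette (`sum_fresh_shared_eq`), and the six two-plaquette rows of the closed-form vectors vanish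
- evasions_known: none needed (positive statement); for `u₁u₂ ≠ 0` see `PlaquetteWalkDominoGenericTriviality` (the class is empty off an explicit hypersurface); what happens ON that hypersurface off the known families is not claimed here
- scope_caveats: horizontal dominoes (vertical ones follow by the diagonal reflection, not typed here); exact constant-coefficient identities of the five-weight class only; `t = 0` excluded
- status: established — `PlaquetteWalkDominoIdentity_holds` (this file); mechanism in print: Temperley's transfer recursions for partially directed walks [cite: JansevanRensburg2015, §4.6]; the typed two-plaquette statement for the GM class is the venture lane's (NEW-IN-WRITING, modest)
[cite: GlazmanManolescu2019, Lemma 2.1] -/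
def _root_.Literature.Barriers.CriticalPhenomena.PlaquetteWalkDominoIdentity : Prop :=
  (∀ (W : CWeights) (t : ℂ), t ≠ 0 → W.u₁ = 0 →
    ExactDominoVertexRelation W t (branchDominoCoeff W.u₂ W.v t) ∧
      (¬((W.v = 0 ∧ W.u₂ ^ 2 = 1) ∨ (W.u₂ = 0 ∧ W.v ^ 2 = 1)) → branchDominoCoeff W.u₂ W.v t ≠ 0)) ∧
  (∀ (W : CWeights) (t : ℂ), t ≠ 0 → W.u₂ = 0 →
    ExactDominoVertexRelation W t (branchDominoCoeffMirror W.u₁ W.v t) ∧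
      (¬((W.v = 0 ∧ W.u₁ ^ 2 = 1) ∨ (W.u₁ = 0 ∧ W.v ^ 2 = 1)) → branchDominoCoeffMirror W.u₁ W.v t ≠ 0))

/-- **`PlaquetteWalkDominoIdentity` holds.** [cite: GlazmanManolescu2019, Lemma 2.1] -/
theorem _root_.Literature.Barriers.CriticalPhenomena.PlaquetteWalkDominoIdentity_holds :
    PlaquetteWalkDominoIdentity :=
  ⟨fun W _ ht h1 => ⟨exactDominoVertexRelation_branch W ht h1, fun h => branchDominoCoeff_ne_zero ht h⟩,
    fun W _ ht h2 => ⟨exactDominoVertexRelation_mirrorBranch W ht h2,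
      fun h => branchDominoCoeffMirror_ne_zero ht h⟩⟩

end Named

end PlaquetteWalk

end Literature.Barriers.CriticalPhenomena
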